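import Mathlib
import Literature.MathematicalPhysics.KineticTheory.InfiniteChainCovarianceMixingBox
import HarnessLib

/-!
# Clustering transfer: space–time ℓ¹-clustering of the infinite chain from spatial mixing and
# fixed-time `L²`-locality of the flow

Topic `Literature/MathematicalPhysics/KineticTheory`; theorems only (no definitions, no named facts),
part 2 of the clustering transfer (part 1, the tools and the box form of mixing:
`InfiniteChainCovarianceMixingBox.lean`); companion of `ZeroWavenumberDataOfClustering.lean`
(which consumes summable clustering of the generators `j₀, h₀` as its single analytic input).

The **assembly step** of the space–time clustering of local observables of the infinite anharmonic
chain (Buttà–Marchioro 2016 §3 locality + exponential mixing of the one-dimensional Gibbs state,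
Cassandro–Olivieri–Pellegrinotti–Presutti 1978 §3), isolated as abstract measure theory on
`ChainConfig = ℤ → ℝ × ℝ`. Inputs, all hypotheses:

* (M) **exponential ρ-mixing** of a probability measure `μ` between half-lines — verbatim the form of
  the registered statement `stub_regularMixing` of crux `GreenKuboContinuation` (line
  temperature-blind-vitali-hurwitz): for `f` depending on the sites `≤ p` and `g` on the sites
  `≥ p + n` (measurable, square integrable),
  `|∫ f g dμ - ∫ f dμ ∫ g dμ| ≤ C e^{-m n} (∫ f²)^{1/2} (∫ g²)^{1/2}`;
* invariance of `μ` under the lattice translations `τ_x = chainShift x` (for a shift-invariant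
  state: `IsShiftInvariant.measurePreserving_chainShift`, `InfiniteChainGoodSetSymmetries.lean`);
* a box-local square-integrable observable `a` (depends on the sites in `[-R, R]`);
* (L) **`L²`-locality** of a square-integrable observable `g` (typically `g = b ∘ φ_u`, an evolved
  local observable): for every `n`, an approximant `h_n` depending on the sites in
  `[-(n+K), n+K]` with `(∫ (g - h_n)²)^{1/2} ≤ ε_n`, `Σ ε_n < ∞`.

Outputs:

* `exists_summable_majorant_covariance_comp_chainShift` — a summable `F : ℤ → ℝ`, depending on
  `g` only through a bound `G` on `(∫ g²)^{1/2}` and the locality rate `ε`, with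
  `|Cov_μ(a, g ∘ τ_x)| ≤ F x` for all `x`;
* `summable_covariance_comp_chainShift` — `Σ_x |Cov_μ(a, g ∘ τ_x)| < ∞`, and the same for
  `x ↦ Cov_μ(a, (b ∘ τ_x) ∘ φ)` when `φ` commutes with the translations
  (`summable_covariance_comp_chainShift_comp`), the shape of the space–time clustering clause of
  the registered statement `stub_gibbsClustering` of cruxes `MourreDissolution` / `DrudeDissolution`;
* `continuousAt_tsum_covariance_comp_chainShift` — if a family `g_t` satisfies (L) UNIFORMLY for `t`
  near `0` and each term `t ↦ Cov_μ(a, g_t ∘ τ_x)` is continuous at `0`, then so is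
  `t ↦ Σ_x Cov_μ(a, g_t ∘ τ_x)` (dominated convergence for series, Tannery), and the same in the
  shape `t ↦ Σ_x Cov_μ(a, (a ∘ τ_x) ∘ φ_t)` (`continuousAt_tsum_covariance_comp_chainShift_comp`) —
  the continuity clause of `stub_gibbsClustering`.

Relation to `ChainMixingClustering.lean` (landed concurrently, same inputs): that file proves the
uniform majorant in the `Integrable … Measure.count` form consumed by `ZeroWavenumberData`
(`exists_summable_clustering_majorant`, `integrable_count_covariance_comp_chainShift`); this file
gives an independent majorant (no sign condition on `C`, approximants asked one `n` at a time) and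
the `Summable` forms and the continuity-at-`0` clause in the exact shapes of `stub_gibbsClustering`.

Everything is proved; tagged `[folklore]`.
-/

noncomputable section

open MeasureTheory ProbabilityTheory Filter Set Function
open scoped Topology

namespace Literature.MathematicalPhysics.KineticTheory.HeatConduction

/-! ### §2 Summable majorant, ℓ¹-clustering, continuity at `t = 0` -/

section Transfer

variable {μ : Measure ChainConfig} [IsProbabilityMeasure μ] {C m : ℝ}

/-- Summability over `ℤ` of a sequence indexed by `|x|` (local copy; cf.
`summable_int_comp_natAbs` of `ChainMixingClustering`). [folklore] -/
private theorem summable_comp_natAbs {u : ℕ → ℝ} (hu : Summable u) : Summable fun x : ℤ => u x.natAbs := by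
  refine Summable.of_nat_of_neg ?_ ?_
  · simpa only [Int.natAbs_natCast] using hu
  · simpa only [Int.natAbs_neg, Int.natAbs_natCast] using hu

/-- Summability of `n ↦ ε (n / 2)` from that of `ε` (local copy; the tree's
`ChainMixingClustering.summable_comp_div_two` asks `ε ≥ 0`). [folklore] -/
private theorem summable_comp_div_two' {ε : ℕ → ℝ} (hε : Summable ε) : Summable fun n : ℕ => ε (n / 2) := by
  refine Summable.even_add_odd ?_ ?_
  · simpa only [Nat.mul_div_cancel_left _ (by norm_num : 0 < 2)] using hε
  · have e : (fun k : ℕ => ε ((2 * k + 1) / 2)) = ε := by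
      funext k; congr 1; omega
    rw [e]; exact hε

/-- The geometric factor of the majorant is summable over `ℤ`:
`x ↦ exp (-m (|x| - (|x|/2 + K) - R)₊)` for `m > 0`. [folklore] -/
theorem summable_exp_neg_mul_gap {m : ℝ} (hm : 0 < m) (K R : ℕ) :
    Summable fun x : ℤ =>
      Real.exp (-(m * (((|x| - ((x.natAbs / 2 + K : ℕ) : ℤ) - R).toNat : ℕ) : ℝ))) := by
  -- compare with the geometric sequence `exp(m (K + R)) · exp(-m/2)^{|x|}`
  set r : ℝ := Real.exp (-(m / 2)) with hr
  have hr0 : 0 ≤ r := (Real.exp_pos _).le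
  have hr1 : r < 1 := Real.exp_lt_one_iff.2 (by linarith)
  have hgeo : Summable fun j : ℕ => Real.exp (m * (K + R)) * r ^ j :=
    (summable_geometric_of_lt_one hr0 hr1).mul_left _
  have hgeoZ := summable_comp_natAbs hgeo
  refine Summable.of_nonneg_of_le (fun x => (Real.exp_pos _).le) (fun x => ?_) hgeoZ
  -- pointwise: `exp(-m k) ≤ exp(m(K+R)) r^{|x|}` since `k ≥ |x|/2 - K - R`
  set j : ℕ := x.natAbs with hj
  have hxj : |x| = (j : ℤ) := by rw [hj, Int.natCast_natAbs]
  set z : ℤ := |x| - ((j / 2 + K : ℕ) : ℤ) - R with hz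
  have hk : (z : ℝ) ≤ ((z.toNat : ℕ) : ℝ) := by exact_mod_cast Int.self_le_toNat z
  have hz_ge : (j : ℝ) / 2 - K - R ≤ (z : ℝ) := by
    have hdiv : ((j / 2 : ℕ) : ℝ) ≤ (j : ℝ) / 2 := Nat.cast_div_le
    have : (z : ℝ) = (j : ℝ) - ((j / 2 : ℕ) : ℝ) - K - R := by
      rw [hz, hxj]; simp only [Int.cast_sub, Int.cast_add, Int.cast_natCast, Nat.cast_add]; ring
    rw [this]; linarith
  have hpow : r ^ j = Real.exp (-(m / 2) * j) := by
    rw [hr, ← Real.exp_nat_mul]; ring_nf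
  calc Real.exp (-(m * ((z.toNat : ℕ) : ℝ)))
      ≤ Real.exp (m * (K + R) + -(m / 2) * j) := Real.exp_le_exp.2 (by nlinarith)
    _ = Real.exp (m * (K + R)) * r ^ j := by rw [hpow, Real.exp_add]

/-- **Summable majorant (clustering transfer).** Under exponential ρ-mixing between half-lines
(`hmix`, `0 < m`) and translation invariance of `μ`, fix a box-local square-integrable `a`
(sites in `[-R, R]`), a locality margin `K`, a level `G` and a summable rate `ε ≥ 0`. Then there is a
summable `F : ℤ → ℝ` such that EVERY measurable square-integrable `g` with `(∫ g²)^{1/2} ≤ G` which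
admits, for each `n`, an approximant `h` depending on the sites in `[-(n+K), n+K]` with
`(∫ (g-h)²)^{1/2} ≤ ε n`, satisfies `|Cov_μ(a, g ∘ τ_x)| ≤ F x` for all `x ∈ ℤ`
(`F x = max C 1 · (∫a²)^{1/2} (G + ε(|x|/2)) e^{-m(|x| - |x|/2 - K - R)₊} + (∫a²)^{1/2} ε(|x|/2)`).
[folklore] -/
theorem exists_summable_majorant_covariance_comp_chainShift
    (hmix : ∀ (p : ℤ) (n : ℕ) (f g : ChainConfig → ℝ),
      DependsOn f {i : ℤ | i ≤ p} → DependsOn g {i : ℤ | p + n ≤ i} →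
      Measurable f → Measurable g → MemLp f 2 μ → MemLp g 2 μ →
      |MeasureTheory.integral μ (fun σ => f σ * g σ) -
          MeasureTheory.integral μ f * MeasureTheory.integral μ g| ≤
        C * Real.exp (-(m * n)) * (MeasureTheory.integral μ (fun σ => f σ ^ 2)) ^ (1 / 2 : ℝ) *
          (MeasureTheory.integral μ (fun σ => g σ ^ 2)) ^ (1 / 2 : ℝ))
    (hm : 0 < m) (hτ : ∀ x : ℤ, MeasurePreserving (chainShift x) μ μ)
    {a : ChainConfig → ℝ} {R : ℕ}
    (ha : DependsOn a (Set.Icc (-(R : ℤ)) R)) (ham : Measurable a) (ha2 : MemLp a 2 μ)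
    (K : ℕ) (G : ℝ) {ε : ℕ → ℝ} (hε0 : ∀ n, 0 ≤ ε n) (hε : Summable ε) :
    ∃ F : ℤ → ℝ, Summable F ∧
      ∀ g : ChainConfig → ℝ, Measurable g → MemLp g 2 μ → Real.sqrt (∫ σ, g σ ^ 2 ∂μ) ≤ G →
        (∀ n : ℕ, ∃ h : ChainConfig → ℝ, DependsOn h (Set.Icc (-((n + K : ℕ) : ℤ)) (n + K : ℕ)) ∧
          Measurable h ∧ MemLp h 2 μ ∧ Real.sqrt (∫ σ, (g σ - h σ) ^ 2 ∂μ) ≤ ε n) →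
        ∀ x : ℤ, |cov[a, g ∘ chainShift x; μ]| ≤ F x := by
  set A := Real.sqrt (∫ σ, a σ ^ 2 ∂μ) with hA
  have hA0 : 0 ≤ A := Real.sqrt_nonneg _
  have hC0 : 0 ≤ max C 1 := zero_le_one.trans (le_max_right _ _)
  -- the majorant
  let e : ℤ → ℝ := fun x =>
    Real.exp (-(m * (((|x| - ((x.natAbs / 2 + K : ℕ) : ℤ) - R).toNat : ℕ) : ℝ)))
  let F : ℤ → ℝ := fun x => max C 1 * A * (G + ε (x.natAbs / 2)) * e x + A * ε (x.natAbs / 2)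
  have he0 : ∀ x, 0 ≤ e x := fun x => (Real.exp_pos _).le
  have he1 : ∀ x, e x ≤ 1 := fun x => Real.exp_le_one_iff.2 (by
    have : (0 : ℝ) ≤ ((|x| - ((x.natAbs / 2 + K : ℕ) : ℤ) - R).toNat : ℕ) := Nat.cast_nonneg _
    nlinarith)
  have hεZ : Summable fun x : ℤ => ε (x.natAbs / 2) := summable_comp_natAbs (summable_comp_div_two' hε)
  have heZ : Summable e := summable_exp_neg_mul_gap hm K R
  refine ⟨F, ?_, ?_⟩
  · -- summability of `F`
    have h1 : Summable fun x : ℤ => max C 1 * A * G * e x := heZ.mul_left _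
    have h2 : Summable fun x : ℤ => max C 1 * A * (ε (x.natAbs / 2) * e x) := by
      refine (Summable.of_nonneg_of_le (fun x => mul_nonneg (hε0 _) (he0 x))
        (fun x => ?_) hεZ).mul_left _
      calc ε (x.natAbs / 2) * e x ≤ ε (x.natAbs / 2) * 1 :=
            mul_le_mul_of_nonneg_left (he1 x) (hε0 _)
        _ = ε (x.natAbs / 2) := mul_one _
    have h3 : Summable fun x : ℤ => A * ε (x.natAbs / 2) := hεZ.mul_left _
    have e3 : F = fun x => max C 1 * A * G * e x + max C 1 * A * (ε (x.natAbs / 2) * e x) +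
        A * ε (x.natAbs / 2) := by
      funext x; simp only [F]; ring
    rw [e3]
    exact (h1.add h2).add h3
  · intro g hgm hg2 hgG hloc x
    obtain ⟨h, hhdep, hhm, hh2, hherr⟩ := hloc (x.natAbs / 2)
    have hgx2 : MemLp (g ∘ chainShift x) 2 μ := hg2.comp_measurePreserving (hτ x)
    have hhx2 : MemLp (h ∘ chainShift x) 2 μ := hh2.comp_measurePreserving (hτ x)
    have hsub2 : MemLp (fun σ => g σ - h σ) 2 μ := hg2.sub hh2
    have hsubx2 : MemLp ((fun σ => g σ - h σ) ∘ chainShift x) 2 μ :=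
      hsub2.comp_measurePreserving (hτ x)
    -- split `g = h + (g - h)` behind the translation
    rw [covariance_comp_eq_add_sub ha2 hgx2 hhx2]
    refine (abs_add_le _ _).trans ?_
    -- the local part, by the box form of mixing
    have hloc_le := abs_covariance_comp_chainShift_le_of_mixing hmix hτ ha ham ha2 hhdep hhm hh2 x
    have hB : Real.sqrt (∫ σ, h σ ^ 2 ∂μ) ≤ G + ε (x.natAbs / 2) :=
      (sqrt_integral_sq_le_add_sqrt_integral_sub_sq hg2 hh2).trans (add_le_add hgG hherr)
    have hgap : (|x| - ((x.natAbs / 2 + K : ℕ) : ℤ) - R) =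
        (|x| - ((x.natAbs / 2 + K : ℕ) : ℕ) - R) := rfl
    have h1 : |cov[a, h ∘ chainShift x; μ]| ≤ max C 1 * A * (G + ε (x.natAbs / 2)) * e x := by
      refine hloc_le.trans ?_
      have : max C 1 * e x * A * Real.sqrt (∫ σ, h σ ^ 2 ∂μ) ≤ max C 1 * e x * A * (G + ε (x.natAbs / 2)) :=
        mul_le_mul_of_nonneg_left hB (mul_nonneg (mul_nonneg hC0 (he0 x)) hA0)
      calc max C 1 * Real.exp (-(m * (((|x| - ((x.natAbs / 2 + K : ℕ) : ℕ) - R).toNat : ℕ) : ℝ))) * A *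
            Real.sqrt (∫ σ, h σ ^ 2 ∂μ)
          = max C 1 * e x * A * Real.sqrt (∫ σ, h σ ^ 2 ∂μ) := rfl
        _ ≤ max C 1 * e x * A * (G + ε (x.natAbs / 2)) := this
        _ = max C 1 * A * (G + ε (x.natAbs / 2)) * e x := by ring
    -- the remainder, by Cauchy–Schwarz and translation invariance
    have h2 : |cov[a, (fun σ => g σ - h σ) ∘ chainShift x; μ]| ≤ A * ε (x.natAbs / 2) := by
      refine (abs_covariance_le_sqrt_integral_sq_mul ha2 hsubx2).trans ?_
      rw [integral_sq_comp_chainShift (hτ x) hsub2.aestronglyMeasurable]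
      exact mul_le_mul_of_nonneg_left hherr hA0
    exact add_le_add h1 h2

/-- **ℓ¹ space–time clustering (clustering transfer).** Under exponential ρ-mixing between
half-lines and translation invariance, for a box-local square-integrable `a` and a measurable
square-integrable `g` that is `L²`-approximable by observables localised in `[-(n+K), n+K]` at a
summable rate, `x ↦ Cov_μ(a, g ∘ τ_x)` is (absolutely) summable over `ℤ`. Typical use: `g = b ∘ φ_u`,
an evolved local observable of the Buttà–Marchioro flow, the approximants being `b` composed with
the severed flows in the boxes `[-n, n]`. [folklore] -/
theorem summable_covariance_comp_chainShift
    (hmix : ∀ (p : ℤ) (n : ℕ) (f g : ChainConfig → ℝ),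
      DependsOn f {i : ℤ | i ≤ p} → DependsOn g {i : ℤ | p + n ≤ i} →
      Measurable f → Measurable g → MemLp f 2 μ → MemLp g 2 μ →
      |MeasureTheory.integral μ (fun σ => f σ * g σ) -
          MeasureTheory.integral μ f * MeasureTheory.integral μ g| ≤
        C * Real.exp (-(m * n)) * (MeasureTheory.integral μ (fun σ => f σ ^ 2)) ^ (1 / 2 : ℝ) *
          (MeasureTheory.integral μ (fun σ => g σ ^ 2)) ^ (1 / 2 : ℝ))
    (hm : 0 < m) (hτ : ∀ x : ℤ, MeasurePreserving (chainShift x) μ μ)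
    {a : ChainConfig → ℝ} {R : ℕ}
    (ha : DependsOn a (Set.Icc (-(R : ℤ)) R)) (ham : Measurable a) (ha2 : MemLp a 2 μ)
    (K : ℕ)
    {g : ChainConfig → ℝ} (hgm : Measurable g) (hg2 : MemLp g 2 μ)
    {ε : ℕ → ℝ} (hε0 : ∀ n, 0 ≤ ε n) (hε : Summable ε)
    (hloc : ∀ n : ℕ, ∃ h : ChainConfig → ℝ, DependsOn h (Set.Icc (-((n + K : ℕ) : ℤ)) (n + K : ℕ)) ∧
      Measurable h ∧ MemLp h 2 μ ∧ Real.sqrt (∫ σ, (g σ - h σ) ^ 2 ∂μ) ≤ ε n) :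
    Summable fun x : ℤ => cov[a, g ∘ chainShift x; μ] := by
  obtain ⟨F, hF, hb⟩ := exists_summable_majorant_covariance_comp_chainShift hmix hm hτ ha ham ha2 K
    (Real.sqrt (∫ σ, g σ ^ 2 ∂μ)) hε0 hε
  exact Summable.of_norm_bounded hF fun x => by
    rw [Real.norm_eq_abs]; exact hb g hgm hg2 le_rfl hloc x

/-- A map commuting with the translations can be moved across them inside an observable:
`(b ∘ τ_x) ∘ φ = (b ∘ φ) ∘ τ_x`. [folklore] -/
theorem comp_chainShift_comp_eq {β : Type*} {φ : ChainConfig → ChainConfig} {x : ℤ}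
    (hφ : φ ∘ chainShift x = chainShift x ∘ φ) (b : ChainConfig → β) :
    (b ∘ chainShift x) ∘ φ = (b ∘ φ) ∘ chainShift x := by
  rw [Function.comp_assoc, ← hφ, ← Function.comp_assoc]

/-- **ℓ¹ space–time clustering, in the shape of the clustering clause of `stub_gibbsClustering`.**
For a map `φ` commuting with the translations (e.g. the time-`u` map of the canonical
Buttà–Marchioro dynamics, `flow_chainShift_of_eq_id`), a box-local square-integrable `a` and an
observable `b` whose evolution `b ∘ φ` is measurable, square integrable and `L²`-approximable by
observables localised in `[-(n+K), n+K]` at a summable rate, `x ↦ Cov_μ(a, (b ∘ τ_x) ∘ φ)` is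
summable over `ℤ`. [folklore] -/
theorem summable_covariance_comp_chainShift_comp
    (hmix : ∀ (p : ℤ) (n : ℕ) (f g : ChainConfig → ℝ),
      DependsOn f {i : ℤ | i ≤ p} → DependsOn g {i : ℤ | p + n ≤ i} →
      Measurable f → Measurable g → MemLp f 2 μ → MemLp g 2 μ →
      |MeasureTheory.integral μ (fun σ => f σ * g σ) -
          MeasureTheory.integral μ f * MeasureTheory.integral μ g| ≤
        C * Real.exp (-(m * n)) * (MeasureTheory.integral μ (fun σ => f σ ^ 2)) ^ (1 / 2 : ℝ) *
          (MeasureTheory.integral μ (fun σ => g σ ^ 2)) ^ (1 / 2 : ℝ))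
    (hm : 0 < m) (hτ : ∀ x : ℤ, MeasurePreserving (chainShift x) μ μ)
    {a : ChainConfig → ℝ} {R : ℕ}
    (ha : DependsOn a (Set.Icc (-(R : ℤ)) R)) (ham : Measurable a) (ha2 : MemLp a 2 μ)
    (K : ℕ)
    {φ : ChainConfig → ChainConfig} (hφ : ∀ x : ℤ, φ ∘ chainShift x = chainShift x ∘ φ)
    {b : ChainConfig → ℝ} (hbm : Measurable (b ∘ φ)) (hb2 : MemLp (b ∘ φ) 2 μ)
    {ε : ℕ → ℝ} (hε0 : ∀ n, 0 ≤ ε n) (hε : Summable ε)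
    (hloc : ∀ n : ℕ, ∃ h : ChainConfig → ℝ, DependsOn h (Set.Icc (-((n + K : ℕ) : ℤ)) (n + K : ℕ)) ∧
      Measurable h ∧ MemLp h 2 μ ∧ Real.sqrt (∫ σ, ((b ∘ φ) σ - h σ) ^ 2 ∂μ) ≤ ε n) :
    Summable fun x : ℤ => cov[a, (b ∘ chainShift x) ∘ φ; μ] := by
  have e : (fun x : ℤ => cov[a, (b ∘ chainShift x) ∘ φ; μ]) =
      fun x : ℤ => cov[a, (b ∘ φ) ∘ chainShift x; μ] := by
    funext x; rw [comp_chainShift_comp_eq (hφ x)]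
  rw [e]
  exact summable_covariance_comp_chainShift hmix hm hτ ha ham ha2 K hbm hb2 hε0 hε hloc

/-- **Continuity at `t = 0` of the summed covariances (clustering transfer, uniform version).** If a
family `g_t` of measurable square-integrable observables is, for `t` near `0`, bounded in `L²` by `G`
and `L²`-approximable by observables localised in `[-(n+K), n+K]` at a summable rate `ε` NOT
depending on `t`, and every term `t ↦ Cov_μ(a, g_t ∘ τ_x)` is continuous at `0`, then
`t ↦ Σ_x Cov_μ(a, g_t ∘ τ_x)` is continuous at `0` (dominated convergence for series, with the
summable majorant of `exists_summable_majorant_covariance_comp_chainShift`). [folklore] -/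
theorem continuousAt_tsum_covariance_comp_chainShift
    (hmix : ∀ (p : ℤ) (n : ℕ) (f g : ChainConfig → ℝ),
      DependsOn f {i : ℤ | i ≤ p} → DependsOn g {i : ℤ | p + n ≤ i} →
      Measurable f → Measurable g → MemLp f 2 μ → MemLp g 2 μ →
      |MeasureTheory.integral μ (fun σ => f σ * g σ) -
          MeasureTheory.integral μ f * MeasureTheory.integral μ g| ≤
        C * Real.exp (-(m * n)) * (MeasureTheory.integral μ (fun σ => f σ ^ 2)) ^ (1 / 2 : ℝ) *
          (MeasureTheory.integral μ (fun σ => g σ ^ 2)) ^ (1 / 2 : ℝ))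
    (hm : 0 < m) (hτ : ∀ x : ℤ, MeasurePreserving (chainShift x) μ μ)
    {a : ChainConfig → ℝ} {R : ℕ}
    (ha : DependsOn a (Set.Icc (-(R : ℤ)) R)) (ham : Measurable a) (ha2 : MemLp a 2 μ)
    (K : ℕ)
    (G : ℝ) {ε : ℕ → ℝ} (hε0 : ∀ n, 0 ≤ ε n) (hε : Summable ε) {g : ℝ → ChainConfig → ℝ}
    (hg : ∀ᶠ t in 𝓝 (0 : ℝ), Measurable (g t) ∧ MemLp (g t) 2 μ ∧
      Real.sqrt (∫ σ, g t σ ^ 2 ∂μ) ≤ G ∧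
      ∀ n : ℕ, ∃ h : ChainConfig → ℝ, DependsOn h (Set.Icc (-((n + K : ℕ) : ℤ)) (n + K : ℕ)) ∧
        Measurable h ∧ MemLp h 2 μ ∧ Real.sqrt (∫ σ, (g t σ - h σ) ^ 2 ∂μ) ≤ ε n)
    (hcont : ∀ x : ℤ, ContinuousAt (fun t : ℝ => cov[a, g t ∘ chainShift x; μ]) 0) :
    ContinuousAt (fun t : ℝ => ∑' x : ℤ, cov[a, g t ∘ chainShift x; μ]) 0 := by
  obtain ⟨F, hF, hb⟩ := exists_summable_majorant_covariance_comp_chainShift hmix hm hτ ha ham ha2 K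
    G hε0 hε
  refine tendsto_tsum_of_dominated_convergence hF hcont ?_
  filter_upwards [hg] with t ht
  intro x
  rw [Real.norm_eq_abs]
  exact hb (g t) ht.1 ht.2.1 ht.2.2.1 ht.2.2.2 x

/-- **Continuity at `t = 0`, in the shape of the continuity clause of `stub_gibbsClustering`.** For
a family of maps `φ_t` commuting with the translations (the canonical flow), a box-local measurable
square-integrable `a` such that, for `t` near `0`, `a ∘ φ_t` is measurable, square integrable,
bounded in `L²` by `G` (for a flow preserving `μ`: `G = (∫ a²)^{1/2}`) and `L²`-approximable by
observables localised in `[-(n+K), n+K]` at a summable rate not depending on `t` (fixed-time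
locality of the flow, uniform on compact time intervals), and such that every term
`t ↦ Cov_μ(a, (a ∘ τ_x) ∘ φ_t)` is continuous at `0` (Vitali, `InfiniteChainTwoPointContinuity`),
the summed autocovariance `t ↦ Σ_x Cov_μ(a, (a ∘ τ_x) ∘ φ_t)` is continuous at `0`. [folklore] -/
theorem continuousAt_tsum_covariance_comp_chainShift_comp
    (hmix : ∀ (p : ℤ) (n : ℕ) (f g : ChainConfig → ℝ),
      DependsOn f {i : ℤ | i ≤ p} → DependsOn g {i : ℤ | p + n ≤ i} →
      Measurable f → Measurable g → MemLp f 2 μ → MemLp g 2 μ →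
      |MeasureTheory.integral μ (fun σ => f σ * g σ) -
          MeasureTheory.integral μ f * MeasureTheory.integral μ g| ≤
        C * Real.exp (-(m * n)) * (MeasureTheory.integral μ (fun σ => f σ ^ 2)) ^ (1 / 2 : ℝ) *
          (MeasureTheory.integral μ (fun σ => g σ ^ 2)) ^ (1 / 2 : ℝ))
    (hm : 0 < m) (hτ : ∀ x : ℤ, MeasurePreserving (chainShift x) μ μ)
    {a : ChainConfig → ℝ} {R : ℕ}
    (ha : DependsOn a (Set.Icc (-(R : ℤ)) R)) (ham : Measurable a) (ha2 : MemLp a 2 μ)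
    (K : ℕ)
    (G : ℝ) {ε : ℕ → ℝ} (hε0 : ∀ n, 0 ≤ ε n) (hε : Summable ε) {φ : ℝ → ChainConfig → ChainConfig}
    (hφ : ∀ (t : ℝ) (x : ℤ), φ t ∘ chainShift x = chainShift x ∘ φ t)
    (hg : ∀ᶠ t in 𝓝 (0 : ℝ), Measurable (a ∘ φ t) ∧ MemLp (a ∘ φ t) 2 μ ∧
      Real.sqrt (∫ σ, (a ∘ φ t) σ ^ 2 ∂μ) ≤ G ∧
      ∀ n : ℕ, ∃ h : ChainConfig → ℝ, DependsOn h (Set.Icc (-((n + K : ℕ) : ℤ)) (n + K : ℕ)) ∧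
        Measurable h ∧ MemLp h 2 μ ∧ Real.sqrt (∫ σ, ((a ∘ φ t) σ - h σ) ^ 2 ∂μ) ≤ ε n)
    (hcont : ∀ x : ℤ, ContinuousAt (fun t : ℝ => cov[a, (a ∘ chainShift x) ∘ φ t; μ]) 0) :
    ContinuousAt (fun t : ℝ => ∑' x : ℤ, cov[a, (a ∘ chainShift x) ∘ φ t; μ]) 0 := by
  have e : ∀ (t : ℝ) (x : ℤ), cov[a, (a ∘ chainShift x) ∘ φ t; μ] = cov[a, (a ∘ φ t) ∘ chainShift x; μ] :=
    fun t x => by rw [comp_chainShift_comp_eq (hφ t x)]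
  simp only [e] at hcont ⊢
  exact continuousAt_tsum_covariance_comp_chainShift hmix hm hτ ha ham ha2 K G hε0 hε hg hcont

end Transfer

end Literature.MathematicalPhysics.KineticTheory.HeatConduction

end
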